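import Mathlib.Analysis.SpecialFunctions.Exp
import Mathlib.Analysis.SpecialFunctions.Pow.Real
import Mathlib.Analysis.Real.Pi.Bounds
import Mathlib.Analysis.Complex.ExponentialBounds
import HarnessLib

/-!
# K2R `RealisedQuasiStaticCellLaw`, line `floquet-bloch`, stub `stub_upperSome`: the scalar inequalities of the cell
# constants (helper; `--supports stmt-AnomalousDissipation-20446`)

Summits-side helper file (everything proved; no definitions, no named facts; real arithmetic only). At the replayed
cell word `W″ = (cubatureWord.stretch M).stretch (1/ν)` with `κ = ν/n²` the slot constants of the slaved-ladder road are
`Λ_j = 4π²|m_j|²ν`, `τ″_j = Mτ_j/ν`, `T_j = Λ_jτ″_j = 4π²|m_j|²Mτ_j ≥ 1579M`, `g_j = θ_j/(8π²|m_j|³nν)` with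
`|g_j| ≤ G/(8π²)`, `G = ‖ℓ‖/(nν)`. This file discharges, in the reals, the numeric hypotheses of
`upperSome_galerkin_lower` (`hsmall`, `hθ34`, `hθf`, `hc`, `hβη`) and the per-slot pieces of the rate budget
`slack + 26βη + drift·ΣA ≤ (δ-ε)X/3`, under `10⁴MG ≤ δ ≤ 1`, `M ≥ 1000/δ²`, `‖ℓ‖/n ≤ δ/(10⁹M)`, `ε = δ/8`,
`Δ = 7/16`, `β = 2/(Δε)`.
This is NOT a proof of Onsager's conjecture nor of anomalous dissipation.
-/

set_option linter.dupNamespace false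

noncomputable section

namespace Summit.AnomalousDissipation.AnomalousDissipation.Theorems.SolenoidalFractalHomogenisation.RealisedQuasiStaticCellLaw

open Real

/-- `9.869 < π² < 9.87`. -/
theorem pi_sq_bounds : 9.869 < π ^ 2 ∧ π ^ 2 < 9.87 := by
  have h1 := Real.pi_gt_d4
  have h2 := Real.pi_lt_d4
  constructor <;> nlinarith

/-- `exp(-x) ≤ 1/4` for `x ≥ 2`. -/
theorem exp_neg_le_quarter {x : ℝ} (hx : 2 ≤ x) : exp (-x) ≤ 1 / 4 := by
  have h1 : (2 : ℝ) ≤ exp 1 := by have := Real.add_one_le_exp (1 : ℝ); linarith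
  have h2 : (4 : ℝ) ≤ exp 2 := by
    rw [show (2 : ℝ) = 1 + 1 by norm_num, Real.exp_add]; nlinarith [Real.exp_pos (1 : ℝ)]
  have h3 : exp (-x) ≤ exp (-2) := Real.exp_le_exp.2 (by linarith)
  have h4 : exp (-2) = 1 / exp 2 := by rw [Real.exp_neg, one_div]
  rw [h4] at h3
  exact h3.trans (one_div_le_one_div_of_le (by norm_num) h2)

/-- `3/4 ≤ exp(-x)` for `x ≤ 1/4`. -/
theorem three_quarters_le_exp_neg {x : ℝ} (hx : x ≤ 1 / 4) : 3 / 4 ≤ exp (-x) := by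
  have := Real.add_one_le_exp (-x); linarith

/-- **Slot coupling bounds at the cell.** With `g = θ/(8π²·f·b·n·ν)` (`|θ| ≤ a`, `b² = f ≥ 1`, `b ≥ 1`),
`T = 4π²fMτ` (`40 ≤ τ ≤ 40f²`) and `G = a/(nν)`: `|g| ≤ G/(8π²)`, `Tg² ≤ 5MG²/(2π²)`, `T|g| ≤ MτG/2`,
`1579M ≤ T`. -/
theorem cell_coupling_bounds {θ a f b n ν M τ G g T : ℝ} (hθ : |θ| ≤ a) (hf1 : 1 ≤ f) (hbf : b ^ 2 = f)
    (hb1 : 1 ≤ b) (hτ40 : 40 ≤ τ) (hτu : τ ≤ 40 * f ^ 2) (hn : 0 < n) (hν : 0 < ν) (hM : 0 < M)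
    (hG : G = a / (n * ν)) (hg : g = θ / (8 * π ^ 2 * f * b * n * ν)) (hT : T = 4 * π ^ 2 * f * M * τ) :
    |g| ≤ G / (8 * π ^ 2) ∧ T * g ^ 2 ≤ 5 * M * G ^ 2 / (2 * π ^ 2) ∧ T * |g| ≤ M * τ * G / 2 ∧ 1579 * M ≤ T ∧
      0 < T := by
  have hπ := pi_sq_bounds
  have ha : 0 ≤ a := (abs_nonneg θ).trans hθ
  have hnν : 0 < n * ν := mul_pos hn hν
  have hG0 : 0 ≤ G := by rw [hG]; positivity
  have hD : 0 < 8 * π ^ 2 * f * b * n * ν := by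
    have : 0 < f * b := by nlinarith
    positivity
  have hga : |g| = |θ| / (8 * π ^ 2 * f * b * n * ν) := by rw [hg, abs_div, abs_of_pos hD]
  -- `|g| ≤ G/(8π² f b) ≤ G/(8π²)`
  have hg1 : |g| ≤ G / (8 * π ^ 2 * f * b) := by
    have e : G / (8 * π ^ 2 * f * b) = a / (8 * π ^ 2 * f * b * n * ν) := by
      rw [hG]; field_simp
    rw [hga, e]
    exact div_le_div_of_nonneg_right hθ hD.le
  have hfb : 1 ≤ f * b := by nlinarith
  have hg2 : |g| ≤ G / (8 * π ^ 2) := by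
    refine hg1.trans ?_
    rw [div_le_div_iff₀ (by positivity) (by positivity)]
    have : G * (8 * π ^ 2) * 1 ≤ G * (8 * π ^ 2) * (f * b) := mul_le_mul_of_nonneg_left hfb (by positivity)
    nlinarith
  have hT0 : 0 < T := by rw [hT]; positivity
  refine ⟨hg2, ?_, ?_, ?_, hT0⟩
  · -- `T g² = (T|g|)|g| ≤ …`
    have h1 : T * g ^ 2 = T * |g| ^ 2 := by rw [sq_abs]
    have h2 : T * |g| ^ 2 ≤ T * (G / (8 * π ^ 2 * f * b)) ^ 2 :=
      mul_le_mul_of_nonneg_left (pow_le_pow_left₀ (abs_nonneg _) hg1 2) hT0.le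
    rw [h1]
    refine h2.trans ?_
    rw [hT, div_pow, show (8 * π ^ 2 * f * b) ^ 2 = 64 * π ^ 4 * f ^ 2 * b ^ 2 by ring, hbf]
    rw [show 4 * π ^ 2 * f * M * τ * (G ^ 2 / (64 * π ^ 4 * f ^ 2 * f)) = M * G ^ 2 * (τ / f ^ 2) / (16 * π ^ 2) by
      field_simp; ring]
    have h3 : τ / f ^ 2 ≤ 40 := by rw [div_le_iff₀ (by positivity)]; exact hτu
    have h4 : M * G ^ 2 * (τ / f ^ 2) ≤ M * G ^ 2 * 40 := mul_le_mul_of_nonneg_left h3 (by positivity)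
    rw [div_le_div_iff₀ (by positivity) (by positivity)]
    nlinarith
  · have h2 : T * |g| ≤ T * (G / (8 * π ^ 2 * f * b)) := mul_le_mul_of_nonneg_left hg1 hT0.le
    refine h2.trans ?_
    rw [hT, show 4 * π ^ 2 * f * M * τ * (G / (8 * π ^ 2 * f * b)) = M * τ * G / 2 * (1 / b) by field_simp; ring]
    have : 1 / b ≤ 1 := by rw [div_le_one (by positivity)]; exact hb1
    have h0 : 0 ≤ M * τ * G / 2 := by positivity
    nlinarith
  · rw [hT]
    have : 1579 ≤ 4 * π ^ 2 * f * τ := by nlinarith [mul_le_mul hf1 hτ40 (by norm_num) (by linarith)]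
    nlinarith

/-- **The fast decay factors at the cell**: `max(exp(-ΛΔτ″), exp(-8π²κ(n/2)²τ″)) ≤ 1/4`
(`Λτ″ = T ≥ 1579M`, `8π²κ(n/2)²τ″ = 2π²Mτ`, `M ≥ 1`, `τ ≥ 40`). -/
theorem cell_theta_fast {Λ τ'' T M τ ν n Δ : ℝ} (hT : Λ * τ'' = T) (hTM : 1579 * M ≤ T) (hM : 1 ≤ M)
    (hτ40 : 40 ≤ τ) (hn : 0 < n) (hν : 0 < ν) (hτ'' : τ'' = M * τ / ν) (hΔ : Δ = 7 / 16) :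
    max (exp (-(Λ * Δ) * τ'')) (exp (-(8 * π ^ 2 * (ν / n ^ 2) * (n / 2) ^ 2) * τ'')) ≤ 1 / 4 := by
  have hπ := pi_sq_bounds
  refine max_le ?_ ?_
  · rw [show -(Λ * Δ) * τ'' = -(Λ * τ'' * Δ) by ring, hT, hΔ]
    exact exp_neg_le_quarter (by nlinarith)
  · rw [hτ'', show -(8 * π ^ 2 * (ν / n ^ 2) * (n / 2) ^ 2) * (M * τ / ν) = -(2 * π ^ 2 * (M * τ)) by
      field_simp; ring]
    exact exp_neg_le_quarter (by nlinarith [mul_le_mul hM hτ40 (by norm_num) (by linarith)])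

/-- **The cone constant**: with `η = 8G²/π⁴`, `12·(2g²(2+γ²)/Δ²) ≤ η` (`|g| ≤ G/(8π²)`, `γ² ≤ 2`, `Δ = 7/16`),
`η ≤ 1` and `βη ≤ 1/2` (`β = 2/(Δε)`, `ε = δ/8`, `G² ≤ δ/10⁴`, `G ≤ 1`). -/
theorem cell_cone_constant {g G γ Δ β ε δ η : ℝ} (hg : |g| ≤ G / (8 * π ^ 2)) (hγ : γ ^ 2 ≤ 2) (hΔ : Δ = 7 / 16)
    (hβ : β = 2 / (Δ * ε)) (hε : ε = δ / 8) (hδ : 0 < δ) (hG1 : G ≤ 1) (hGδ : G ^ 2 ≤ δ / 10 ^ 4)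
    (hη : η = 8 * G ^ 2 / π ^ 4) :
    12 * (2 * g ^ 2 * (2 + γ ^ 2) / Δ ^ 2) ≤ η ∧ η ≤ 1 ∧ β * η ≤ 1 / 2 := by
  have hπ := pi_sq_bounds
  have hG0 : 0 ≤ G := by
    by_contra hneg
    push Not at hneg
    have h1 : G / (8 * π ^ 2) < 0 := div_neg_of_neg_of_pos hneg (by positivity)
    linarith [(abs_nonneg g).trans hg]
  have hg2 : g ^ 2 ≤ G ^ 2 / (64 * π ^ 4) := by
    rw [← sq_abs, show G ^ 2 / (64 * π ^ 4) = (G / (8 * π ^ 2)) ^ 2 by field_simp; ring]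
    exact pow_le_pow_left₀ (abs_nonneg _) hg 2
  have hπ4 : 97 < π ^ 4 := by nlinarith
  refine ⟨?_, ?_, ?_⟩
  · rw [hη, hΔ]
    have hγg : g ^ 2 * γ ^ 2 ≤ g ^ 2 * 2 := mul_le_mul_of_nonneg_left hγ (sq_nonneg g)
    have h1 : 12 * (2 * g ^ 2 * (2 + γ ^ 2) / (7 / 16 : ℝ) ^ 2) ≤ 502 * g ^ 2 := by
      have e : 12 * (2 * g ^ 2 * (2 + γ ^ 2) / (7 / 16 : ℝ) ^ 2) = 6144 / 49 * (2 * g ^ 2 + g ^ 2 * γ ^ 2) := by ring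
      rw [e]; nlinarith [sq_nonneg g]
    refine h1.trans ?_
    rw [show 8 * G ^ 2 / π ^ 4 = 512 * (G ^ 2 / (64 * π ^ 4)) by field_simp; ring]
    nlinarith [sq_nonneg g]
  · rw [hη, div_le_one (by positivity)]
    nlinarith
  · rw [hβ, hΔ, hε, hη]
    rw [show 2 / (7 / 16 * (δ / 8)) * (8 * G ^ 2 / π ^ 4) = 2048 * G ^ 2 / (7 * δ * π ^ 4) by field_simp; ring,
      div_le_iff₀ (by positivity)]
    have hδ1 : δ / 10 ^ 4 ≤ δ := by
      have := hδ.le; nlinarith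
    nlinarith [hGδ.trans hδ1]


/-- Common small-parameter facts: `0 ≤ G ≤ 10⁻⁷`, `|g| ≤ G/78`, `MG² ≤ δG/10⁴`. -/
theorem cell_small_facts {g G δ M : ℝ} (hg : |g| ≤ G / (8 * π ^ 2)) (hGs : 10 ^ 4 * M * G ≤ δ) (hδ1 : δ ≤ 1)
    (hM : 1000 ≤ M) :
    0 ≤ G ∧ G ≤ 1 / 10 ^ 7 ∧ |g| ≤ G / 78 ∧ M * G ^ 2 ≤ δ * G / 10 ^ 4 ∧ g ^ 2 ≤ G ^ 2 / 6084 ∧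
      10 ^ 7 * G ≤ δ := by
  have hπ := pi_sq_bounds
  have hG0 : 0 ≤ G := by
    by_contra hneg
    push Not at hneg
    have h1 : G / (8 * π ^ 2) < 0 := div_neg_of_neg_of_pos hneg (by positivity)
    linarith [(abs_nonneg g).trans hg]
  have hGδ : 10 ^ 7 * G ≤ δ := by
    have := mul_le_mul_of_nonneg_right hM (by positivity : (0:ℝ) ≤ 10 ^ 4 * G)
    linarith
  have hGu : G ≤ 1 / 10 ^ 7 := by
    rw [le_div_iff₀ (by norm_num)]
    linarith
  have hg78 : |g| ≤ G / 78 := by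
    refine hg.trans ?_
    rw [div_le_div_iff₀ (by positivity) (by norm_num)]
    have := mul_le_mul_of_nonneg_left hπ.1.le hG0
    linarith
  refine ⟨hG0, hGu, hg78, ?_, ?_, hGδ⟩
  · rw [le_div_iff₀ (by norm_num)]
    have := mul_le_mul_of_nonneg_right hGs hG0
    linarith [show M * G ^ 2 * 10 ^ 4 = 10 ^ 4 * M * G * G by ring]
  · rw [← sq_abs, show G ^ 2 / 6084 = (G / 78) ^ 2 by ring]
    exact pow_le_pow_left₀ (abs_nonneg _) hg78 2

/-- **The slaving smallness condition at the cell** (`hsmallo` with `c = 2, σ = σ_o ≤ 4`; `hsmalli` with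
`c = γ² ≤ 2, σ = σ_i ≤ 28`). -/
theorem cell_hsmall {g G δ ε M σ c Δ β Λ τ'' ρ T : ℝ} (hg : |g| ≤ G / (8 * π ^ 2)) (hGs : 10 ^ 4 * M * G ≤ δ)
    (hδ : 0 < δ) (hδ1 : δ ≤ 1) (hM : 1000 ≤ M) (hε : ε = δ / 8) (hσ0 : 0 ≤ σ) (hσ : σ ≤ 28)
    (hc : c ≤ 2) (hΔ : Δ = 7 / 16) (hβ : β = 2 / (Δ * ε)) (hρ : ρ = 1 / 2) (hΛ : 0 < Λ) (hτ : 0 < τ'')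
    (hT : Λ * τ'' = T) (hTM : 1579 * M ≤ T) :
    g ^ 2 * (4 * c / Δ + 2 * (1 + ε) * σ) +
      2 * (4 * β * c * (Λ * |g| ^ 3 * σ + |g| / (ρ * τ'') + Λ * |g| ^ 2) ^ 2 / (Λ * Δ ^ 3)) / Λ ≤ Δ := by
  have hπ := pi_sq_bounds
  obtain ⟨hG0, hGu, hg78, -, -, hGδ⟩ := cell_small_facts hg hGs hδ1 hM
  obtain ⟨a, ha⟩ : ∃ a, a = |g| := ⟨_, rfl⟩
  have ha0 : 0 ≤ a := by rw [ha]; exact abs_nonneg _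
  have hau : a ≤ 1 / 10 ^ 8 := by rw [ha]; linarith
  have hT0 : 0 < T := by rw [← hT]; positivity
  have hTl : (10 : ℝ) ^ 6 ≤ T := by linarith
  rw [show g ^ 2 = |g| ^ 2 from (sq_abs g).symm, ← ha]
  -- the reduced slaved remainder `s`
  obtain ⟨s, hs⟩ : ∃ s, s = a ^ 3 * σ + a / (ρ * T) + a ^ 2 := ⟨_, rfl⟩
  have hS : Λ * a ^ 3 * σ + a / (ρ * τ'') + Λ * a ^ 2 = Λ * s := by
    rw [hs, ← hT]; field_simp
  have hΔ0 : Δ ≠ 0 := by rw [hΔ]; norm_num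
  have e2 : 2 * (4 * β * c * (Λ * s) ^ 2 / (Λ * Δ ^ 3)) / Λ = 8 * β * c / Δ ^ 3 * s ^ 2 := by
    field_simp
    ring
  rw [hS, e2]
  -- `s ≤ a`
  have hs0 : 0 ≤ s := by rw [hs, hρ]; positivity
  have hsa : s ≤ a := by
    rw [hs, hρ]
    have h1 : a / (1 / 2 * T) = 2 * a / T := by field_simp
    rw [h1]
    have h2 : 2 * a / T ≤ 2 * a / 10 ^ 6 := div_le_div_of_nonneg_left (by positivity) (by norm_num) hTl
    nlinarith [mul_nonneg ha0 hσ0, mul_nonneg (mul_nonneg ha0 ha0) hσ0]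
  -- term one
  have h1 : a ^ 2 * (4 * c / Δ + 2 * (1 + ε) * σ) ≤ a := by
    rw [hΔ, hε]
    have hc1 : 4 * c / (7 / 16 : ℝ) + 2 * (1 + δ / 8) * σ ≤ 82 := by nlinarith
    have : a ^ 2 * (4 * c / (7 / 16 : ℝ) + 2 * (1 + δ / 8) * σ) ≤ a ^ 2 * 82 :=
      mul_le_mul_of_nonneg_left hc1 (sq_nonneg a)
    nlinarith
  -- term two
  have h2 : 8 * β * c / Δ ^ 3 * s ^ 2 ≤ a := by
    have hδ0 : δ ≠ 0 := hδ.ne'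
    have hβv : β = 256 / (7 * δ) := by rw [hβ, hΔ, hε]; field_simp; norm_num
    have hk : 8 * β * c / Δ ^ 3 ≤ 7000 / δ := by
      have e3 : 8 * β * c / Δ ^ 3 = 8388608 / 2401 * c / δ := by rw [hβv, hΔ]; field_simp; ring
      rw [e3]
      exact div_le_div_of_nonneg_right (by linarith) hδ.le
    have hs2 : s ^ 2 ≤ a ^ 2 := pow_le_pow_left₀ hs0 hsa 2
    have h3 : 8 * β * c / Δ ^ 3 * s ^ 2 ≤ 7000 / δ * a ^ 2 :=
      mul_le_mul hk hs2 (sq_nonneg _) (div_nonneg (by norm_num) hδ.le)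
    refine h3.trans ?_
    have h7 : a / δ ≤ 1 / (78 * 10 ^ 7) := by
      rw [div_le_div_iff₀ hδ (by norm_num)]
      have : a * 78 ≤ G := by rw [le_div_iff₀ (by norm_num)] at hg78; rw [ha]; exact hg78
      linarith
    calc 7000 / δ * a ^ 2 = 7000 * a * (a / δ) := by field_simp
      _ ≤ 7000 * a * (1 / (78 * 10 ^ 7)) := mul_le_mul_of_nonneg_left h7 (by positivity)
      _ ≤ a := by linarith
  rw [hΔ] at h1 h2 ⊢
  linarith

set_option maxHeartbeats 400000 in
/-- **The slow-slot survival factor at the cell** (`hθo34` with `c = 2, σ = σ_o`; `hθi34` with `c = γ², σ = σ_i`):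
the exponent is at most `1/4`. -/
theorem cell_theta34 {g G δ ε M σ c Δ β Λ τ'' ρ T d₀ r : ℝ} (hg : |g| ≤ G / (8 * π ^ 2))
    (hGs : 10 ^ 4 * M * G ≤ δ) (hδ : 0 < δ) (hδ1 : δ ≤ 1) (hM : 1000 ≤ M) (hε : ε = δ / 8) (hσ0 : 0 ≤ σ)
    (hσ : σ ≤ 28) (hc0 : 0 ≤ c) (hc : c ≤ 2) (hΔ : Δ = 7 / 16) (hβ : β = 2 / (Δ * ε)) (hρ : ρ = 1 / 2)
    (hΛ : 0 < Λ) (hτ : 0 < τ'') (hT : Λ * τ'' = T) (hTM : 1579 * M ≤ T) (hTu : T ≤ 42650 * M)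
    (hTg : T * g ^ 2 ≤ 5 * M * G ^ 2 / (2 * π ^ 2)) (hd0 : 0 ≤ d₀) (hd : d₀ ≤ r ^ 2) (hr0 : 0 ≤ r)
    (hr : r ≤ δ / (10 ^ 9 * M)) :
    3 / 4 ≤ exp (-(2 * Λ * τ'' * (d₀ + (1 + ε) * σ * (g ^ 2 * (1 - 4 * ρ / 3))) +
      40 * β * c * Λ * τ'' * g ^ 4 * (1 + g ^ 2 * σ ^ 2) / Δ ^ 3 + 48 * β * c * g ^ 2 / (ρ * τ'' * Λ * Δ ^ 3))) := by
  have hπ := pi_sq_bounds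
  obtain ⟨hG0, hGu, hg78, hMG2, hg2, hGδ⟩ := cell_small_facts hg hGs hδ1 hM
  have hM0 : 0 < M := by linarith
  have hT0 : 0 < T := by rw [← hT]; positivity
  have hg2u : g ^ 2 ≤ 1 / 10 ^ 17 := by
    refine hg2.trans ?_
    rw [div_le_div_iff₀ (by norm_num) (by norm_num)]
    nlinarith
  have hMG : M * G ^ 2 ≤ 1 / 10 ^ 11 := by
    refine hMG2.trans ?_
    rw [div_le_div_iff₀ (by norm_num) (by norm_num)]
    nlinarith
  have hTg' : T * g ^ 2 ≤ 3 / 10 * (M * G ^ 2) := by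
    refine hTg.trans ?_
    rw [div_le_iff₀ (by positivity)]
    have h0 := mul_nonneg hM0.le (sq_nonneg G)
    have := mul_le_mul_of_nonneg_left hπ.1.le h0
    linarith
  have hTg0 : 0 ≤ T * g ^ 2 := by positivity
  refine three_quarters_le_exp_neg ?_
  have hΛ0 : Λ ≠ 0 := hΛ.ne'
  have hτ0 : τ'' ≠ 0 := hτ.ne'
  have hΔ0 : Δ ≠ 0 := by rw [hΔ]; norm_num
  have hρ0 : ρ ≠ 0 := by rw [hρ]; norm_num
  -- rewrite in terms of `T`
  have e : 2 * Λ * τ'' * (d₀ + (1 + ε) * σ * (g ^ 2 * (1 - 4 * ρ / 3))) +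
      40 * β * c * Λ * τ'' * g ^ 4 * (1 + g ^ 2 * σ ^ 2) / Δ ^ 3 + 48 * β * c * g ^ 2 / (ρ * τ'' * Λ * Δ ^ 3) =
      2 * T * d₀ + 2 * (1 + ε) * (1 - 4 * ρ / 3) * σ * (T * g ^ 2) +
        40 * c / Δ ^ 3 * β * (T * g ^ 2) * g ^ 2 * (1 + g ^ 2 * σ ^ 2) + 48 * c / (ρ * Δ ^ 3) * β * g ^ 2 / T := by
    rw [← hT]
    field_simp
    try ring
  rw [e]
  clear e
  -- E1
  have E1 : 2 * T * d₀ ≤ 1 / 16 := by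
    have h1 : M * r ≤ δ / 10 ^ 9 := by
      have := mul_le_mul_of_nonneg_left hr hM0.le
      rwa [show M * (δ / (10 ^ 9 * M)) = δ / 10 ^ 9 by field_simp] at this
    have h2 : T * d₀ ≤ 42650 * M * r ^ 2 := (mul_le_mul hTu hd hd0 (by positivity))
    have h1' : M * r ≤ 1 / 10 ^ 9 := h1.trans (by rw [div_le_div_iff₀ (by norm_num) (by norm_num)]; linarith)
    have h3 : M * r * r ≤ 1 / 10 ^ 9 * r := mul_le_mul_of_nonneg_right h1' hr0
    have h4 : r ≤ 1 / 10 ^ 9 := by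
      have h5 : M * r ≤ 1 / 10 ^ 9 := h1'
      have h6 : 1 * r ≤ M * r := mul_le_mul_of_nonneg_right (by linarith) hr0
      linarith
    linarith [show 42650 * M * r ^ 2 = 42650 * (M * r * r) by ring]
  -- E2
  have E2 : 2 * (1 + ε) * (1 - 4 * ρ / 3) * σ * (T * g ^ 2) ≤ 1 / 16 := by
    rw [hε, hρ]
    have h1 : 2 * (1 + δ / 8) * (1 - 4 * (1 / 2 : ℝ) / 3) * σ ≤ 21 := by nlinarith
    have h2 : 2 * (1 + δ / 8) * (1 - 4 * (1 / 2 : ℝ) / 3) * σ * (T * g ^ 2) ≤ 21 * (T * g ^ 2) :=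
      mul_le_mul_of_nonneg_right h1 hTg0
    nlinarith
  have hδ0 : δ ≠ 0 := hδ.ne'
  have hβv : β = 256 / (7 * δ) := by rw [hβ, hΔ, hε]; field_simp; norm_num
  have hβ0 : 0 ≤ β := by rw [hβv]; positivity
  -- E3
  have E3 : 40 * c / Δ ^ 3 * β * (T * g ^ 2) * g ^ 2 * (1 + g ^ 2 * σ ^ 2) ≤ 1 / 16 := by
    have hP : 40 * c / Δ ^ 3 * β ≤ 35000 / δ := by
      have e3 : 40 * c / Δ ^ 3 * β = 41943040 / 2401 * c / δ := by rw [hβv, hΔ]; field_simp; ring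
      rw [e3]
      exact div_le_div_of_nonneg_right (by linarith only [hc]) hδ.le
    have hP0 : 0 ≤ 40 * c / Δ ^ 3 * β := by rw [hΔ]; positivity
    have hQ : T * g ^ 2 ≤ 3 * δ * G / 10 ^ 5 := by linarith only [hTg', hMG2]
    have hPQ : 40 * c / Δ ^ 3 * β * (T * g ^ 2) ≤ 35000 / δ * (3 * δ * G / 10 ^ 5) :=
      mul_le_mul hP hQ hTg0 (div_nonneg (by norm_num) hδ.le)
    have e4 : 35000 / δ * (3 * δ * G / 10 ^ 5) = 21 / 20 * G := by field_simp; ring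
    rw [e4] at hPQ
    have hσ2 : g ^ 2 * σ ^ 2 ≤ 1 / 10 ^ 17 * 28 ^ 2 :=
      mul_le_mul hg2u (pow_le_pow_left₀ hσ0 hσ 2) (sq_nonneg _) (by norm_num)
    have h2 : g ^ 2 * (1 + g ^ 2 * σ ^ 2) ≤ 1 / 10 ^ 17 * 2 :=
      mul_le_mul hg2u (by linarith only [hσ2]) (by positivity) (by norm_num)
    have h3 : 40 * c / Δ ^ 3 * β * (T * g ^ 2) * (g ^ 2 * (1 + g ^ 2 * σ ^ 2)) ≤ 21 / 20 * G * (1 / 10 ^ 17 * 2) :=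
      mul_le_mul hPQ h2 (by positivity) (by positivity)
    rw [show 40 * c / Δ ^ 3 * β * (T * g ^ 2) * g ^ 2 * (1 + g ^ 2 * σ ^ 2) =
      40 * c / Δ ^ 3 * β * (T * g ^ 2) * (g ^ 2 * (1 + g ^ 2 * σ ^ 2)) by ring]
    exact h3.trans (by linarith only [hGu, hG0])
  -- E4
  have E4 : 48 * c / (ρ * Δ ^ 3) * β * g ^ 2 / T ≤ 1 / 16 := by
    have hP : 48 * c / (ρ * Δ ^ 3) * β ≤ 84000 / δ := by
      have e3 : 48 * c / (ρ * Δ ^ 3) * β = 100663296 / 2401 * c / δ := by rw [hβv, hΔ, hρ]; field_simp; ring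
      rw [e3]
      exact div_le_div_of_nonneg_right (by linarith only [hc]) hδ.le
    rw [div_le_iff₀ hT0]
    have h1 : 48 * c / (ρ * Δ ^ 3) * β * g ^ 2 ≤ 84000 / δ * (G ^ 2 / 6084) :=
      mul_le_mul hP hg2 (sq_nonneg _) (div_nonneg (by norm_num) hδ.le)
    have hGd : G / δ ≤ 1 / 10 ^ 7 := by
      rw [div_le_div_iff₀ hδ (by norm_num)]
      linarith only [hGδ]
    have e4 : 84000 / δ * (G ^ 2 / 6084) = 84000 / 6084 * G * (G / δ) := by field_simp
    have h2 : 84000 / 6084 * G * (G / δ) ≤ 84000 / 6084 * G * (1 / 10 ^ 7) := mul_le_mul_of_nonneg_left hGd (by positivity)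
    rw [e4] at h1
    linarith only [h1, h2, hGu, hG0, hTM, hM]
  linarith


end Summit.AnomalousDissipation.AnomalousDissipation.Theorems.SolenoidalFractalHomogenisation.RealisedQuasiStaticCellLaw

end
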